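import Mathlib.Geometry.Manifold.SmoothEmbedding
import Mathlib.Geometry.Manifold.ContMDiff.Atlas
import HarnessLib

/-!
# Gluing charted spaces along two open embeddings (trunk T-4MAN, prelude `FourManM`)

The standard construction of a smooth atlas on a space `P` covered by the images of two open
topological embeddings `jA : A → P`, `jB : B → P` of smooth manifolds whose *transition map*
`jB⁻¹ ∘ jA` (an open partial homeomorphism `A ⇀ B`) is smooth in both directions
(Hirsch, *Differential Topology*, Ch. 8 §2 "Gluing manifolds together", p. 184; Kosinski,
*Differential Manifolds*, VI.1 and I.(5.1); Lee, *Introduction to Smooth Manifolds*, Lemma 1.35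
"smooth manifold chart lemma"). It is a chart-level counterpart of the relational predicate
`Literature.Topology.FourManifolds.IsOpenGluing` of `Literature.Topology.FourManifolds.ConnectedSum` for a *given* space `P`,
and is used in `Literature.Topology.FourManifolds.MappingTorusSmoothProofs` to put the smooth
structure on the concrete mapping torus `MappingTorus φ = M × ℝ / ℤ`
(`Literature.Topology.FourManifolds.exists_isMappingTorusOf_holds`).

## Relation to `GluingConstruction` (division of labour)

`Literature.Topology.FourManifolds.GluingConstruction` treats the same mathematics from the other
end: from a gluing datum `e : A ⇀ B` (`Literature.Topology.FourManifolds.SmoothGlueData`, real Banach models, `C^∞`,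
boundaryless pieces) it *constructs* the pushout space `d.Glued` together with `ChartedSpace` /
`IsManifold` instances, the smooth embeddings `inl`, `inr` and the certificate `d.isOpenGluing`
(specialised to the two cylinders of a mapping torus in
`Literature.Topology.FourManifolds.MappingTorusGlue`, `Literature.Topology.FourManifolds.MappingTorusGlued`); its lemma
`contDiffOn_lift_symm_trans_lift` is the same transition-chart computation as
`symm_trans_trans_mem_contDiffGroupoid` below. The present file instead starts from a space `P`
that is *already given* together with two open embeddings covering it (`Literature.Topology.FourManifolds.IsOpenCover₂`) and
only manufactures the atlas (as a term `IsOpenCover₂.chartedSpace`, never an instance), for an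
arbitrary field `𝕜`, regularity `n`, models with corners and a change of model `f : H ≃ₜ H'`.
Use `GluingConstruction` when any glued manifold will do (existential statements), and this file
when the smooth structure is wanted on a specific quotient or union (e.g. `MappingTorus φ`).
(Convention note: the charts here go through `IsOpenEmbedding.toOpenPartialHomeomorph`, whereas
`GluingConstruction` and Mathlib's `ChartedSpace` on sums use
`OpenPartialHomeomorph.lift_openEmbedding`.)

We allow a change of model along the way: the pieces `A`, `B` are charted over `H` (model with
corners `I : ModelWithCorners 𝕜 E H`) while `P` is to be charted over `H'`
(`I' : ModelWithCorners 𝕜 E' H'`), the two being related by a homeomorphism `f : H ≃ₜ H'` which is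
a diffeomorphism of the model spaces (in the application, `H = 𝔼ⁿ × ℝ`, `H' = 𝔼ⁿ⁺¹` and `f` is a
linear isomorphism).

## Main definitions and results

* `Literature.IsOpenCover₂ jA jB`: `jA`, `jB` are open embeddings whose ranges cover `P`.
* `Literature.IsOpenCover₂.chartedSpace h f`: the glued `ChartedSpace H' P`; its charts are
  `jA.symm ≫ₕ c ≫ₕ f` (`c` a chart of `A`) and `jB.symm ≫ₕ c ≫ₕ f` (`c` a chart of `B`).
* `Literature.Topology.FourManifolds.IsOpenCover₂.hasGroupoid`: if `f` conjugates the structure groupoid `G` of the pieces into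
  `G'` and the transition charts `c.symm ≫ₕ (jA ≫ₕ jB.symm) ≫ₕ c'` lie in `G`, the glued space
  has structure groupoid `G'`.
* `Literature.Topology.FourManifolds.mem_contDiffGroupoid_iff_contMDiffOn`: an open partial homeomorphism of the model space
  is in `contDiffGroupoid n I` iff it and its inverse are `C^n`.
* `Literature.Topology.FourManifolds.symm_trans_trans_mem_contDiffGroupoid`: if `D : A ⇀ B` and its inverse are `C^n` then the
  transition charts `c.symm ≫ₕ D ≫ₕ c'` are in `contDiffGroupoid n I`.
* `Literature.Topology.FourManifolds.IsOpenCover₂.isManifold`: hence the glued space is a `C^n` manifold when the transition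
  map `jA ≫ₕ jB.symm` and its inverse are `C^n`.
* `Literature.Topology.FourManifolds.isSmoothEmbedding_of_symm_trans_chartAt_mem_maximalAtlas`,
  `Literature.IsOpenCover₂.isSmoothEmbedding_left/right`: `jA` and `jB` are smooth embeddings into the
  glued manifold (Mathlib's chart-wise notion `Manifold.IsSmoothEmbedding`), provided the model
  change `f` is linear in the charts `I`, `I'` (`I' (f x) = L (I x)`).

## Mathlib status

Mathlib (v4.32.0) has the one-chart case `IsOpenEmbedding.singletonChartedSpace` /
`singleton_hasGroupoid` and charted-space structures on open subsets, sums and quotients, but no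
gluing of two charted spaces along open embeddings (`rg -n "glu" Mathlib/Geometry/Manifold` finds
only sheaf gluing). Everything here is proved. [folklore]
-/

open scoped Manifold ContDiff Topology
open Set Function Topology

noncomputable section

namespace Literature.Topology.FourManifolds

/-! ### Two open embeddings covering a space -/

section Cover

variable {H H' : Type*} [TopologicalSpace H] [TopologicalSpace H']
  {A B P : Type*} [TopologicalSpace A] [TopologicalSpace B] [TopologicalSpace P]

/-- `IsOpenCover₂ jA jB`: the maps `jA : A → P`, `jB : B → P` are open topological embeddings whose
ranges cover `P`. This is the topological datum from which `P` inherits an atlas glued from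
atlases of `A` and `B` (Hirsch, *Differential Topology*, Ch. 8 §2). [folklore] -/
structure IsOpenCover₂ (jA : A → P) (jB : B → P) : Prop where
  isOpenEmbedding_left : IsOpenEmbedding jA
  isOpenEmbedding_right : IsOpenEmbedding jB
  union_range_eq : range jA ∪ range jB = univ

namespace IsOpenCover₂

variable {jA : A → P} {jB : B → P} (h : IsOpenCover₂ jA jB)
include h

/-- Swapping the two pieces of an open cover. [folklore] -/
theorem symm : IsOpenCover₂ jB jA :=
  ⟨h.isOpenEmbedding_right, h.isOpenEmbedding_left, (union_comm _ _).trans h.union_range_eq⟩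

/-- A point not in the range of `jA` is in the range of `jB`. [folklore] -/
theorem mem_range_right_of_notMem {p : P} (hp : p ∉ range jA) : p ∈ range jB :=
  (h.union_range_eq.symm ▸ mem_univ p : p ∈ range jA ∪ range jB).resolve_left hp

/-- The first embedding `jA` as an open partial homeomorphism `A ⇀ P` with source `univ` and
target `range jA`. [folklore] -/
def inl [Nonempty A] : OpenPartialHomeomorph A P :=
  h.isOpenEmbedding_left.toOpenPartialHomeomorph jA

/-- The second embedding `jB` as an open partial homeomorphism `B ⇀ P` with source `univ` and
target `range jB`. [folklore] -/
def inr [Nonempty B] : OpenPartialHomeomorph B P :=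
  h.isOpenEmbedding_right.toOpenPartialHomeomorph jB

/-- `h.inl` is `jA` as a function. [folklore] -/
@[simp, mfld_simps] theorem inl_apply [Nonempty A] : ⇑h.inl = jA := rfl
/-- `h.inr` is `jB` as a function. [folklore] -/
@[simp, mfld_simps] theorem inr_apply [Nonempty B] : ⇑h.inr = jB := rfl
/-- The source of `h.inl` is everything. [folklore] -/
@[simp, mfld_simps] theorem inl_source [Nonempty A] : h.inl.source = univ := rfl
/-- The source of `h.inr` is everything. [folklore] -/
@[simp, mfld_simps] theorem inr_source [Nonempty B] : h.inr.source = univ := rfl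
/-- The target of `h.inl` is `range jA`. [folklore] -/
@[simp, mfld_simps] theorem inl_target [Nonempty A] : h.inl.target = range jA :=
  h.isOpenEmbedding_left.toOpenPartialHomeomorph_target jA
/-- The target of `h.inr` is `range jB`. [folklore] -/
@[simp, mfld_simps] theorem inr_target [Nonempty B] : h.inr.target = range jB :=
  h.isOpenEmbedding_right.toOpenPartialHomeomorph_target jB

/-- `h.inl.symm` is a left inverse of `jA`. [folklore] -/
@[simp, mfld_simps] theorem inl_symm_apply_apply [Nonempty A] (a : A) : h.inl.symm (jA a) = a :=
  h.isOpenEmbedding_left.toOpenPartialHomeomorph_left_inv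
/-- `h.inr.symm` is a left inverse of `jB`. [folklore] -/
@[simp, mfld_simps] theorem inr_symm_apply_apply [Nonempty B] (b : B) : h.inr.symm (jB b) = b :=
  h.isOpenEmbedding_right.toOpenPartialHomeomorph_left_inv

/-- `h.inl.symm` is a right inverse of `jA` on `range jA`. [folklore] -/
theorem apply_inl_symm_apply [Nonempty A] {p : P} (hp : p ∈ range jA) : jA (h.inl.symm p) = p :=
  IsOpenEmbedding.toOpenPartialHomeomorph_right_inv jA h.isOpenEmbedding_left hp
/-- `h.inr.symm` is a right inverse of `jB` on `range jB`. [folklore] -/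
theorem apply_inr_symm_apply [Nonempty B] {p : P} (hp : p ∈ range jB) : jB (h.inr.symm p) = p :=
  IsOpenEmbedding.toOpenPartialHomeomorph_right_inv jB h.isOpenEmbedding_right hp

/-- On `range jA`, `h.inl.symm p = a ↔ p = jA a`. [folklore] -/
theorem inl_symm_apply_eq_iff [Nonempty A] {p : P} (hp : p ∈ range jA) {a : A} :
    h.inl.symm p = a ↔ p = jA a := by
  constructor
  · rintro rfl
    exact (h.apply_inl_symm_apply hp).symm
  · rintro rfl
    exact h.inl_symm_apply_apply a

/-- On `range jB`, `h.inr.symm p = b ↔ p = jB b`. [folklore] -/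
theorem inr_symm_apply_eq_iff [Nonempty B] {p : P} (hp : p ∈ range jB) {b : B} :
    h.inr.symm p = b ↔ p = jB b :=
  h.symm.inl_symm_apply_eq_iff hp

/-- `jA` followed by its partial inverse is the identity of `A` (as open partial homeomorphisms,
since the source of `h.inl` is everything). [folklore] -/
@[simp, mfld_simps] theorem inl_trans_inl_symm [Nonempty A] :
    h.inl ≫ₕ h.inl.symm = OpenPartialHomeomorph.refl A := by
  ext x
  · simp
  · simp
  · simp

/-- `jB` followed by its partial inverse is the identity of `B`. [folklore] -/
@[simp, mfld_simps] theorem inr_trans_inr_symm [Nonempty B] :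
    h.inr ≫ₕ h.inr.symm = OpenPartialHomeomorph.refl B :=
  h.symm.inl_trans_inl_symm

/-- Cancellation of `h.inl ≫ₕ h.inl.symm` in front of a composition. [folklore] -/
@[simp, mfld_simps] theorem inl_trans_inl_symm_trans [Nonempty A] {Z : Type*} [TopologicalSpace Z]
    (e : OpenPartialHomeomorph A Z) : h.inl ≫ₕ h.inl.symm ≫ₕ e = e := by
  rw [← OpenPartialHomeomorph.trans_assoc, inl_trans_inl_symm, OpenPartialHomeomorph.refl_trans]

/-- Cancellation of `h.inr ≫ₕ h.inr.symm` in front of a composition. [folklore] -/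
@[simp, mfld_simps] theorem inr_trans_inr_symm_trans [Nonempty B] {Z : Type*} [TopologicalSpace Z]
    (e : OpenPartialHomeomorph B Z) : h.inr ≫ₕ h.inr.symm ≫ₕ e = e :=
  h.symm.inl_trans_inl_symm_trans e

/-- The transition map `jA ≫ₕ jB.symm : A ⇀ B` of the cover, defined on `jA ⁻¹' (range jB)`.
[folklore] -/
theorem inl_trans_inr_symm_source [Nonempty A] [Nonempty B] :
    (h.inl ≫ₕ h.inr.symm).source = jA ⁻¹' range jB := by
  simp

/-- The transition map `jA ≫ₕ jB.symm` as a function. [folklore] -/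
theorem inl_trans_inr_symm_apply [Nonempty A] [Nonempty B] (a : A) :
    (h.inl ≫ₕ h.inr.symm) a = h.inr.symm (jA a) := rfl

/-! ### The glued charted space -/

variable (f : H ≃ₜ H')

/-- The chart of `P` obtained from a chart `c` of the first piece `A`: `jA.symm ≫ₕ c ≫ₕ f`.
[folklore] -/
def chartInl [Nonempty A] (c : OpenPartialHomeomorph A H) : OpenPartialHomeomorph P H' :=
  h.inl.symm ≫ₕ c ≫ₕ f.toOpenPartialHomeomorph

/-- The chart of `P` obtained from a chart `c` of the second piece `B`: `jB.symm ≫ₕ c ≫ₕ f`.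
[folklore] -/
def chartInr [Nonempty B] (c : OpenPartialHomeomorph B H) : OpenPartialHomeomorph P H' :=
  h.inr.symm ≫ₕ c ≫ₕ f.toOpenPartialHomeomorph

/-- Unfolding of `chartInl`. [folklore] -/
theorem chartInl_def [Nonempty A] (c : OpenPartialHomeomorph A H) :
    h.chartInl f c = h.inl.symm ≫ₕ c ≫ₕ f.toOpenPartialHomeomorph := rfl

/-- Unfolding of `chartInr`. [folklore] -/
theorem chartInr_def [Nonempty B] (c : OpenPartialHomeomorph B H) :
    h.chartInr f c = h.inr.symm ≫ₕ c ≫ₕ f.toOpenPartialHomeomorph := rfl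

/-- `chartInl c` as a function: `f ∘ c ∘ jA.symm`. [folklore] -/
@[simp, mfld_simps] theorem chartInl_apply [Nonempty A] (c : OpenPartialHomeomorph A H) (p : P) :
    h.chartInl f c p = f (c (h.inl.symm p)) := rfl

/-- `chartInr c` as a function: `f ∘ c ∘ jB.symm`. [folklore] -/
@[simp, mfld_simps] theorem chartInr_apply [Nonempty B] (c : OpenPartialHomeomorph B H) (p : P) :
    h.chartInr f c p = f (c (h.inr.symm p)) := rfl

/-- The inverse of `chartInl c` as a function: `jA ∘ c.symm ∘ f.symm`. [folklore] -/
@[simp, mfld_simps] theorem chartInl_symm_apply [Nonempty A] (c : OpenPartialHomeomorph A H)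
    (y : H') : (h.chartInl f c).symm y = jA (c.symm (f.symm y)) := rfl

/-- The inverse of `chartInr c` as a function: `jB ∘ c.symm ∘ f.symm`. [folklore] -/
@[simp, mfld_simps] theorem chartInr_symm_apply [Nonempty B] (c : OpenPartialHomeomorph B H)
    (y : H') : (h.chartInr f c).symm y = jB (c.symm (f.symm y)) := rfl

/-- The source of `chartInl c` is `jA '' c.source`, written as `range jA ∩ jA.symm ⁻¹' c.source`.
[folklore] -/
@[simp, mfld_simps] theorem chartInl_source [Nonempty A] (c : OpenPartialHomeomorph A H) :
    (h.chartInl f c).source = range jA ∩ h.inl.symm ⁻¹' c.source := by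
  simp [chartInl]

/-- The source of `chartInr c` is `jB '' c.source`, written as `range jB ∩ jB.symm ⁻¹' c.source`.
[folklore] -/
@[simp, mfld_simps] theorem chartInr_source [Nonempty B] (c : OpenPartialHomeomorph B H) :
    (h.chartInr f c).source = range jB ∩ h.inr.symm ⁻¹' c.source := by
  simp [chartInr]

/-- `jA a` is in the source of `chartInl c` iff `a ∈ c.source`. [folklore] -/
theorem apply_mem_chartInl_source [Nonempty A] {c : OpenPartialHomeomorph A H} {a : A} :
    jA a ∈ (h.chartInl f c).source ↔ a ∈ c.source := by
  simp

/-- `jB b` is in the source of `chartInr c` iff `b ∈ c.source`. [folklore] -/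
theorem apply_mem_chartInr_source [Nonempty B] {c : OpenPartialHomeomorph B H} {b : B} :
    jB b ∈ (h.chartInr f c).source ↔ b ∈ c.source := by
  simp

variable [ChartedSpace H A] [ChartedSpace H B]

open Classical in
/-- **The glued charted space.** The `ChartedSpace H' P` structure on a space `P` covered by two
open embeddings `jA : A → P`, `jB : B → P` of charted spaces over `H`, after a change of model
`f : H ≃ₜ H'`: the atlas consists of the charts `jA.symm ≫ₕ c ≫ₕ f`, `c ∈ atlas H A`, and
`jB.symm ≫ₕ c ≫ₕ f`, `c ∈ atlas H B`; the preferred chart at `p` comes from `A` if `p ∈ range jA`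
and from `B` otherwise (Hirsch, *Differential Topology*, Ch. 8 §2; Lee, *Introduction to Smooth
Manifolds*, Lemma 1.35). This is a `def`, to be installed as an instance on the glued type by the
user. [cite: HirschDT1976, Ch. 8 §2, p. 184] [cite: LeeSmoothManifolds2013, Lemma 1.35] -/
@[reducible] def chartedSpace : ChartedSpace H' P where
  atlas := {e | ∃ (_ : Nonempty A) (c : OpenPartialHomeomorph A H), c ∈ atlas H A ∧
      e = h.chartInl f c} ∪
    {e | ∃ (_ : Nonempty B) (c : OpenPartialHomeomorph B H), c ∈ atlas H B ∧ e = h.chartInr f c}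
  chartAt p :=
    if hp : p ∈ range jA then
      haveI : Nonempty A := ⟨hp.choose⟩
      h.chartInl f (chartAt H hp.choose)
    else
      haveI : Nonempty B := ⟨(h.mem_range_right_of_notMem hp).choose⟩
      h.chartInr f (chartAt H (h.mem_range_right_of_notMem hp).choose)
  mem_chart_source p := by
    by_cases hp : p ∈ range jA
    · rw [dif_pos hp]
      haveI : Nonempty A := ⟨hp.choose⟩
      rw [chartInl_source]
      refine ⟨hp, ?_⟩
      rw [mem_preimage, (h.inl_symm_apply_eq_iff hp).2 hp.choose_spec.symm]
      exact mem_chart_source H _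
    · rw [dif_neg hp]
      have hp' := h.mem_range_right_of_notMem hp
      haveI : Nonempty B := ⟨hp'.choose⟩
      rw [chartInr_source]
      refine ⟨hp', ?_⟩
      rw [mem_preimage, (h.inr_symm_apply_eq_iff hp').2 hp'.choose_spec.symm]
      exact mem_chart_source H _
  chart_mem_atlas p := by
    by_cases hp : p ∈ range jA
    · rw [dif_pos hp]
      exact Or.inl ⟨⟨hp.choose⟩, _, chart_mem_atlas H _, rfl⟩
    · rw [dif_neg hp]
      exact Or.inr ⟨⟨(h.mem_range_right_of_notMem hp).choose⟩, _, chart_mem_atlas H _, rfl⟩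

/-- Unfolding of the glued atlas: its members are the `chartInl c`, `c ∈ atlas H A`, and the
`chartInr c`, `c ∈ atlas H B`. [folklore] -/
theorem mem_atlas_chartedSpace_iff {e : OpenPartialHomeomorph P H'} :
    e ∈ (h.chartedSpace f).atlas ↔
      (∃ (_ : Nonempty A) (c : OpenPartialHomeomorph A H), c ∈ atlas H A ∧ e = h.chartInl f c) ∨
      ∃ (_ : Nonempty B) (c : OpenPartialHomeomorph B H), c ∈ atlas H B ∧ e = h.chartInr f c :=
  Iff.rfl

/-- Charts of `A` give charts of the glued space. [folklore] -/
theorem chartInl_mem_atlas [Nonempty A] {c : OpenPartialHomeomorph A H} (hc : c ∈ atlas H A) :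
    h.chartInl f c ∈ (h.chartedSpace f).atlas :=
  Or.inl ⟨‹_›, c, hc, rfl⟩

/-- Charts of `B` give charts of the glued space. [folklore] -/
theorem chartInr_mem_atlas [Nonempty B] {c : OpenPartialHomeomorph B H} (hc : c ∈ atlas H B) :
    h.chartInr f c ∈ (h.chartedSpace f).atlas :=
  Or.inr ⟨‹_›, c, hc, rfl⟩

/-- **Compatibility of the glued atlas.** Suppose the pieces `A`, `B` have structure groupoid `G`
(on `H`), the model change `f : H ≃ₜ H'` conjugates `G` into a groupoid `G'` on `H'`, and the
transition charts `c.symm ≫ₕ (jA ≫ₕ jB.symm) ≫ₕ c'` (`c ∈ atlas H A`, `c' ∈ atlas H B`) belong to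
`G`. Then the glued charted space `P` has structure groupoid `G'` (Hirsch, *Differential Topology*,
Ch. 8 §2; Lee, *Introduction to Smooth Manifolds*, Lemma 1.35).
[cite: HirschDT1976, Ch. 8 §2, p. 184] [cite: LeeSmoothManifolds2013, Lemma 1.35] -/
theorem hasGroupoid {G : StructureGroupoid H} {G' : StructureGroupoid H'} [HasGroupoid A G]
    [HasGroupoid B G]
    (hG : ∀ e ∈ G,
      f.toOpenPartialHomeomorph.symm ≫ₕ e ≫ₕ f.toOpenPartialHomeomorph ∈ G')
    (hAB : ∀ [Nonempty A] [Nonempty B], ∀ c ∈ atlas H A, ∀ c' ∈ atlas H B,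
      c.symm ≫ₕ (h.inl ≫ₕ h.inr.symm) ≫ₕ c' ∈ G) :
    @HasGroupoid _ _ P _ (h.chartedSpace f) G' := by
  letI := h.chartedSpace f
  constructor
  rintro e e' (⟨_, c, hc, rfl⟩ | ⟨_, c, hc, rfl⟩) (⟨_, c', hc', rfl⟩ | ⟨_, c', hc', rfl⟩)
  · -- `A`-chart against `A`-chart
    have := hG _ (HasGroupoid.compatible hc hc')
    simpa only [chartInl_def, OpenPartialHomeomorph.trans_symm_eq_symm_trans_symm,
      OpenPartialHomeomorph.symm_symm, OpenPartialHomeomorph.trans_assoc,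
      inl_trans_inl_symm_trans] using this
  · -- `A`-chart against `B`-chart
    have := hG _ (hAB c hc c' hc')
    simpa only [chartInl_def, chartInr_def, OpenPartialHomeomorph.trans_symm_eq_symm_trans_symm,
      OpenPartialHomeomorph.symm_symm, OpenPartialHomeomorph.trans_assoc] using this
  · -- `B`-chart against `A`-chart: the inverse of the previous case
    have := G'.symm (hG _ (hAB c' hc' c hc))
    simpa only [chartInl_def, chartInr_def, OpenPartialHomeomorph.trans_symm_eq_symm_trans_symm,
      OpenPartialHomeomorph.symm_symm, OpenPartialHomeomorph.trans_assoc] using this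
  · -- `B`-chart against `B`-chart
    have := hG _ (HasGroupoid.compatible hc hc')
    simpa only [chartInr_def, OpenPartialHomeomorph.trans_symm_eq_symm_trans_symm,
      OpenPartialHomeomorph.symm_symm, OpenPartialHomeomorph.trans_assoc,
      inr_trans_inr_symm_trans] using this

end IsOpenCover₂

end Cover

/-! ### The `C^n` groupoid: transition charts and conjugation -/

section ContDiff

variable {𝕜 : Type*} [NontriviallyNormedField 𝕜]
  {E E' : Type*} [NormedAddCommGroup E] [NormedSpace 𝕜 E] [NormedAddCommGroup E']
  [NormedSpace 𝕜 E']
  {H H' : Type*} [TopologicalSpace H] [TopologicalSpace H']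
  {I : ModelWithCorners 𝕜 E H} {I' : ModelWithCorners 𝕜 E' H'} {n : WithTop ℕ∞}
  {A B P : Type*} [TopologicalSpace A] [TopologicalSpace B] [TopologicalSpace P]

/-- An open partial homeomorphism of the model space `H` belongs to `contDiffGroupoid n I` iff it
and its inverse are `C^n` in the manifold sense (`H` charted over itself). One direction is
Mathlib's `contMDiffOn_of_mem_contDiffGroupoid`. [folklore] -/
theorem mem_contDiffGroupoid_iff_contMDiffOn (e : OpenPartialHomeomorph H H) :
    e ∈ contDiffGroupoid n I ↔
      ContMDiffOn I I n e e.source ∧ ContMDiffOn I I n e.symm e.target := by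
  rw [← IsManifold.mem_maximalAtlas_iff_contMDiffOn]
  constructor
  · exact StructureGroupoid.mem_maximalAtlas_of_mem_groupoid _
  · intro he
    have := StructureGroupoid.compatible_of_mem_maximalAtlas
      (StructureGroupoid.id_mem_maximalAtlas (contDiffGroupoid n I)) he
    simpa using this

/-- **Conjugating the `C^n` groupoid by a diffeomorphism of model spaces.** If `f : H ≃ₜ H'` is
`C^n` from `(H, I)` to `(H', I')` with `C^n` inverse, then `e ↦ f.symm ≫ₕ e ≫ₕ f` maps
`contDiffGroupoid n I` into `contDiffGroupoid n I'`. [folklore] -/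
theorem symm_trans_trans_mem_contDiffGroupoid_of_homeomorph (f : H ≃ₜ H')
    (hf : ContMDiff I I' n f) (hf' : ContMDiff I' I n f.symm) {e : OpenPartialHomeomorph H H}
    (he : e ∈ contDiffGroupoid n I) :
    f.toOpenPartialHomeomorph.symm ≫ₕ e ≫ₕ f.toOpenPartialHomeomorph ∈ contDiffGroupoid n I' := by
  rw [mem_contDiffGroupoid_iff_contMDiffOn] at he ⊢
  obtain ⟨he, he'⟩ := he
  constructor
  · have hs : (f.toOpenPartialHomeomorph.symm ≫ₕ e ≫ₕ f.toOpenPartialHomeomorph).source =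
        f.symm ⁻¹' e.source := by
      simp
    rw [hs]
    have : ⇑(f.toOpenPartialHomeomorph.symm ≫ₕ e ≫ₕ f.toOpenPartialHomeomorph) =
        f ∘ e ∘ f.symm := rfl
    rw [this]
    exact hf.comp_contMDiffOn (he.comp hf'.contMDiffOn (mapsTo_preimage _ _))
  · have hs : (f.toOpenPartialHomeomorph.symm ≫ₕ e ≫ₕ f.toOpenPartialHomeomorph).target =
        f.symm ⁻¹' e.target := by
      simp
    rw [hs]
    have : ⇑(f.toOpenPartialHomeomorph.symm ≫ₕ e ≫ₕ f.toOpenPartialHomeomorph).symm =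
        f ∘ e.symm ∘ f.symm := rfl
    rw [this]
    exact hf.comp_contMDiffOn (he'.comp hf'.contMDiffOn (mapsTo_preimage _ _))

/-- A homeomorphism of model spaces `f : H ≃ₜ H'` which reads as a continuous linear isomorphism
`L : E ≃L[𝕜] E'` through the models with corners, `I' (f x) = L (I x)`, is `C^n`. [folklore] -/
theorem Homeomorph.contMDiff_of_apply_eq_linear (f : H ≃ₜ H') (L : E ≃L[𝕜] E')
    (hIf : ∀ x, I' (f x) = L (I x)) : ContMDiff I I' n f := by
  rw [contMDiff_iff]
  refine ⟨f.continuous, fun x y => ?_⟩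
  refine L.contDiff.contDiffOn.congr fun z hz => ?_
  have hz' : z ∈ range I := extChartAt_target_subset_range x hz.1
  obtain ⟨w, rfl⟩ := hz'
  simp [hIf]

/-- The inverse of a homeomorphism of model spaces reading as `L : E ≃L[𝕜] E'` reads as `L.symm`.
[folklore] -/
theorem Homeomorph.symm_apply_eq_linear (f : H ≃ₜ H') (L : E ≃L[𝕜] E')
    (hIf : ∀ x, I' (f x) = L (I x)) (y : H') : I (f.symm y) = L.symm (I' y) := by
  rw [L.eq_symm_apply, ← hIf, f.apply_symm_apply]

variable [ChartedSpace H A] [ChartedSpace H B]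

/-- **Transition charts of a smooth partial homeomorphism are in the `C^n` groupoid.** If
`D : A ⇀ B` is an open partial homeomorphism between `C^n` manifolds over the same model which is
`C^n` on its source with `C^n` inverse, then for all charts `c` of `A` and `c'` of `B` the
transition chart `c.symm ≫ₕ D ≫ₕ c'` belongs to `contDiffGroupoid n I`. Indeed `D ≫ₕ c'` is in
the maximal atlas of `A` (`OpenPartialHomeomorph.mem_maximalAtlas_of_contMDiffOn`) and any two
members of the maximal atlas are compatible (Lee, *Introduction to Smooth Manifolds*, Lemma 1.35).
[cite: LeeSmoothManifolds2013, Lemma 1.35] -/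
theorem symm_trans_trans_mem_contDiffGroupoid [IsManifold I n A] [IsManifold I n B]
    (D : OpenPartialHomeomorph A B) (hD : ContMDiffOn I I n D D.source)
    (hD' : ContMDiffOn I I n D.symm D.target) {c : OpenPartialHomeomorph A H}
    {c' : OpenPartialHomeomorph B H} (hc : c ∈ atlas H A) (hc' : c' ∈ atlas H B) :
    c.symm ≫ₕ D ≫ₕ c' ∈ contDiffGroupoid n I := by
  have h1 : D ≫ₕ c' ∈ IsManifold.maximalAtlas I n A := by
    refine (D ≫ₕ c').mem_maximalAtlas_of_contMDiffOn ?_ ?_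
    · rw [OpenPartialHomeomorph.trans_source, OpenPartialHomeomorph.coe_trans]
      exact (contMDiffOn_of_mem_maximalAtlas (IsManifold.subset_maximalAtlas hc')).comp
        (hD.mono inter_subset_left) fun x hx => hx.2
    · rw [OpenPartialHomeomorph.trans_target, OpenPartialHomeomorph.coe_trans_symm]
      exact (hD'.comp
        ((contMDiffOn_symm_of_mem_maximalAtlas (IsManifold.subset_maximalAtlas hc')).mono
          inter_subset_left) fun x hx => hx.2)
  exact StructureGroupoid.compatible_of_mem_maximalAtlas (IsManifold.subset_maximalAtlas hc) h1

namespace IsOpenCover₂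

variable {jA : A → P} {jB : B → P} (h : IsOpenCover₂ jA jB) (f : H ≃ₜ H')
include h

/-- **The glued space is a `C^n` manifold.** If `A`, `B` are `C^n` manifolds over `(H, I)`, the
model change `f : H ≃ₜ H'` is a `C^n` diffeomorphism of model spaces `(H, I) → (H', I')`, and the
transition map `jA ≫ₕ jB.symm : A ⇀ B` of the cover and its inverse are `C^n`, then `P` with the
glued atlas `h.chartedSpace f` is a `C^n` manifold over `(H', I')` (Hirsch, *Differential
Topology*, Ch. 8 §2; Lee, *Introduction to Smooth Manifolds*, Lemma 1.35, and Thm. 21.13 for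
quotients by discrete groups). [cite: HirschDT1976, Ch. 8 §2, p. 184] [cite: LeeSmoothManifolds2013, Lemma 1.35] -/
theorem isManifold [IsManifold I n A] [IsManifold I n B] (hf : ContMDiff I I' n f)
    (hf' : ContMDiff I' I n f.symm)
    (hD : ∀ [Nonempty A] [Nonempty B],
      ContMDiffOn I I n (h.inl ≫ₕ h.inr.symm) (h.inl ≫ₕ h.inr.symm).source ∧
        ContMDiffOn I I n (h.inl ≫ₕ h.inr.symm).symm (h.inl ≫ₕ h.inr.symm).target) :
    @IsManifold 𝕜 _ E' _ _ H' _ I' n P _ (h.chartedSpace f) := by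
  letI := h.chartedSpace f
  haveI : HasGroupoid P (contDiffGroupoid n I') :=
    h.hasGroupoid f (fun e he => symm_trans_trans_mem_contDiffGroupoid_of_homeomorph f hf hf' he)
      fun c hc c' hc' => symm_trans_trans_mem_contDiffGroupoid _ hD.1 hD.2 hc hc'
  exact IsManifold.mk' I' n P

end IsOpenCover₂

/-! ### Open embeddings compatible with the atlas are smooth embeddings -/

variable [ChartedSpace H' P]

/-- **Chart criterion for smooth embeddings.** Let `j : A → P` be an open topological embedding
of `C^n` manifolds, `A` over `(H, I)` and `P` over `(H', I')`, and let `f : H ≃ₜ H'` read as a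
continuous linear isomorphism `L` through the models (`I' (f x) = L (I x)`). If for every `a : A`
the chart `j.symm ≫ₕ chartAt H a ≫ₕ f` of `P` belongs to the maximal `C^n` atlas of `P`, then `j`
is a `C^n` embedding in Mathlib's chart-wise sense (`Manifold.IsSmoothEmbedding`: an immersion,
read in these charts as `u ↦ L u ≃ (u, 0)`, and a topological embedding). [folklore] -/
theorem isSmoothEmbedding_of_symm_trans_chartAt_mem_maximalAtlas [IsManifold I n A]
    [IsManifold I' n P] {j : A → P} (hj : IsOpenEmbedding j) (f : H ≃ₜ H') (L : E ≃L[𝕜] E')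
    (hIf : ∀ x, I' (f x) = L (I x))
    (hatlas : ∀ [Nonempty A] (a : A),
      (hj.toOpenPartialHomeomorph j).symm ≫ₕ chartAt H a ≫ₕ f.toOpenPartialHomeomorph ∈
        IsManifold.maximalAtlas I' n P) :
    Manifold.IsSmoothEmbedding I I' n j := by
  refine ⟨?_, hj.isEmbedding⟩
  refine ⟨PUnit, by infer_instance, by infer_instance, fun a => ?_⟩
  haveI : Nonempty A := ⟨a⟩
  refine Manifold.IsImmersionAtOfComplement.mk_of_continuousAt hj.continuous.continuousAt
    ((ContinuousLinearEquiv.prodUnique 𝕜 E PUnit).trans L) (chartAt H a)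
    ((hj.toOpenPartialHomeomorph j).symm ≫ₕ chartAt H a ≫ₕ f.toOpenPartialHomeomorph)
    (mem_chart_source H a) ?_ (IsManifold.chart_mem_maximalAtlas a) (hatlas a) ?_
  · simp [hj.toOpenPartialHomeomorph_left_inv]
  · intro z hz
    rw [OpenPartialHomeomorph.extend_target] at hz
    obtain ⟨hz1, hz2⟩ := hz
    obtain ⟨w, rfl⟩ := hz2
    rw [mem_preimage, I.left_inv] at hz1
    simp [hj.toOpenPartialHomeomorph_left_inv, (chartAt H a).right_inv hz1, hIf]

namespace IsOpenCover₂

variable {jA : A → P} {jB : B → P}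

omit [ChartedSpace H' P] in
/-- The first embedding `jA : A → P` of an open cover is a smooth (`C^n`) embedding into the glued
manifold `(P, h.chartedSpace f)`, provided the model change reads as a linear isomorphism `L`
(Hirsch, *Differential Topology*, Ch. 8 §2). [folklore] -/
theorem isSmoothEmbedding_left (h : IsOpenCover₂ jA jB) (f : H ≃ₜ H') [IsManifold I n A]
    (hP : @IsManifold 𝕜 _ E' _ _ H' _ I' n P _ (h.chartedSpace f)) (L : E ≃L[𝕜] E')
    (hIf : ∀ x, I' (f x) = L (I x)) :
    letI := h.chartedSpace f; Manifold.IsSmoothEmbedding I I' n jA := by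
  letI := h.chartedSpace f
  refine isSmoothEmbedding_of_symm_trans_chartAt_mem_maximalAtlas h.isOpenEmbedding_left f L hIf
    fun a => ?_
  exact IsManifold.subset_maximalAtlas (h.chartInl_mem_atlas f (chart_mem_atlas H a))

omit [ChartedSpace H' P] in
/-- The second embedding `jB : B → P` of an open cover is a smooth (`C^n`) embedding into the glued
manifold `(P, h.chartedSpace f)`, provided the model change reads as a linear isomorphism `L`
(Hirsch, *Differential Topology*, Ch. 8 §2). [folklore] -/
theorem isSmoothEmbedding_right (h : IsOpenCover₂ jA jB) (f : H ≃ₜ H') [IsManifold I n B]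
    (hP : @IsManifold 𝕜 _ E' _ _ H' _ I' n P _ (h.chartedSpace f)) (L : E ≃L[𝕜] E')
    (hIf : ∀ x, I' (f x) = L (I x)) :
    letI := h.chartedSpace f; Manifold.IsSmoothEmbedding I I' n jB := by
  letI := h.chartedSpace f
  refine isSmoothEmbedding_of_symm_trans_chartAt_mem_maximalAtlas h.isOpenEmbedding_right f L hIf
    fun b => ?_
  exact IsManifold.subset_maximalAtlas (h.chartInr_mem_atlas f (chart_mem_atlas H b))

end IsOpenCover₂

end ContDiff

end Literature.Topology.FourManifolds
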